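import Literature.NumberTheory.EllipticCurves.X049EtaDescent
import Literature.NumberTheory.QuadraticFields.RingClassNumberFormula
import Literature.NumberTheory.QuadraticFields.FundamentalDiscriminant
import Mathlib.Tactic.NormNum.LegendreSymbol
import HarnessLib

/-!
# (F-D) WITHOUT THE HYPOTHESIS `IsImaginaryQuadratic K` IS FALSE — the junk branches of `heegnerTau` / `ringClassField` off the
# imaginary quadratic fields (kernel refutation of the over-general typing that `deuring_etaQuotient49_heegner_generates_conjPrime` had
# until 2026-08-28; the statement is spelled out inline here, the definition itself is repaired in place / primed in `X049EtaDescent.lean`)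

Cell `bsd-goldfeld`, seat `bsd-goldfeld-s1p-c301` (prover, gen 17). The named fact (F-D) of `X049EtaDescent.lean` (binder `hD` of the
`𝒮|σ=−1` files U2c/U2d/F/R/H2/K of `Summits/BirchSwinnertonDyer/BirchSwinnertonDyer/Theorems/GoldfeldAllTwistsTwoConverseTwin*`) quantifies
over EVERY number field `K`, not only the imaginary quadratic ones for which Deuring's theorem (Lang, *Elliptic Functions*, Ch. 12 §2
Thm 5) is meant. Off those fields the tree's definitions take documented junk values — `heegnerTau Q = i` for a triple that is not
positive definite (§1), and `K[n] = ι(K)` when `n²d_K ≥ 0` has no reduced forms (§1) — and (F-D) then asserts: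
* at `K = ℚ` (`d_ℚ = 1`, Heegner datum `⟨β = 1, {(49, 1, 0)}⟩`): `η(i)/η(49i)` is a rational integer generating `(7)`, i.e. `= ±7` (§2);
* at a real quadratic field of discriminant `8` (Heegner datum `⟨β = 20, {(98, 20, 1)}⟩`): that same number generates `v·𝓞_{K[1]}`,
  `v` a PRIME of `𝓞_K` over `7`, whence `v = (7)` is prime — but `(8/7) = +1`, so `7` splits in `ℚ(√2)` (the tree's decomposition law
  `RingClass.isPrime_span_natCast_iff_jacobiSym_eq_neg_one`). Contradiction: `not_deuring_etaQuotient49_heegner_generates_conjPrime` (§2).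
No numerics on `η` are used. HONEST FRAMING: this refutes the LETTER of the typed statement only; its mathematical content for `K`
imaginary quadratic (the only case any consumer uses, always with `hK : IsImaginaryQuadratic K` in context) is the repaired fact
`deuring_etaQuotient49_heegner_generates_conjPrime'`. Every theorem carrying the unprimed `hD` as a hypothesis is therefore vacuous as
stated until the definition carries the hypothesis (repair in place, 2026-08-28). Nothing here bears on BSD.

References: S. Lang, *Elliptic Functions*, GTM 112 (1987), Ch. 12 §2 Thm 4–5 [Lang1987]; D. A. Cox, *Primes of the form x² + ny²*
(2013), §5.B Prop. 5.16 (decomposition law) and §7.B (orders, ring class fields) [Cox2013].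
-/

noncomputable section

open scoped UpperHalfPlane

open WeierstrassCurve IsDedekindDomain NumberField
open Literature.NumberTheory.EllipticCurves Literature.NumberTheory.EllipticCurves.ModularForms
open Literature.NumberTheory.QuadraticFields.BinaryQuadraticForm (reducedForms IsReduced IsPrimitive)

namespace Literature.NumberTheory.EllipticCurves

/-! ## §1 The junk branches: `heegnerTau` off positive-definite triples, `K[n]` for `d_K ≥ 0` -/

/-- Off the positive-definite triples with `A > 0`, `heegnerTau` returns the documented junk value `I`. [folklore] -/
private theorem heegnerTau_of_not_posDef {Q : ℤ × ℤ × ℤ} (h : ¬ (0 < Q.1 ∧ Q.2.1 ^ 2 - 4 * Q.1 * Q.2.2 < 0)) :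
    heegnerTau Q = UpperHalfPlane.I := by
  unfold heegnerTau
  rw [dif_neg h]

/-- There are no reduced positive-definite forms of non-negative discriminant: `b² ≤ a² ≤ ac` forces `b² − 4ac < 0`. [folklore] -/
private theorem reducedForms_eq_empty_of_nonneg {D : ℤ} (hD : 0 ≤ D) : reducedForms D = ∅ := by
  rw [reducedForms, Finset.image_eq_empty, Finset.filter_eq_empty_iff]
  rintro ⟨a, b⟩ hab ⟨hdvd, -, hred⟩
  simp only [Finset.mem_product, Finset.mem_Icc] at hab
  obtain ⟨c, hc⟩ := hdvd
  have hc' : (b ^ 2 - D) / (4 * a) = c := by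
    rw [hc, Int.mul_ediv_cancel_left _ (by omega)]
  rcases hred with ⟨h1, h2, h3, -⟩
  simp only [hc'] at h3
  have ha : 0 < a := by omega
  have hb2 : b ^ 2 ≤ a ^ 2 := by nlinarith
  nlinarith

variable {K : Type} [Field K] [NumberField K]

/-- For `d_K ≥ 0` (no imaginary quadratic field) there are no singular moduli of discriminant `n²d_K`. [folklore] -/
private theorem ringClassSingularModuli_eq_empty_of_discr_nonneg (hK : 0 ≤ NumberField.discr K) (n : ℕ) :
    ringClassSingularModuli K n = ∅ := by
  rw [ringClassSingularModuli, reducedForms_eq_empty_of_nonneg (by positivity), Finset.image_empty]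

/-- For `d_K ≥ 0`, the "ring class field" `K[n] ⊂ ℂ` is the junk value `ι(K)`. [folklore] -/
private theorem ringClassField_eq_fieldRange_of_discr_nonneg (hK : 0 ≤ NumberField.discr K) (ι : K →+* ℂ) (n : ℕ) :
    ringClassField K ι n = ι.fieldRange := by
  rw [ringClassField, ringClassSingularModuli_eq_empty_of_discr_nonneg hK, Finset.coe_empty, Set.union_empty,
    ← RingHom.coe_fieldRange, Subfield.closure_eq]

/-- For `d_K ≥ 0`, `algebraMap K K[n]` is onto. [folklore] -/
private theorem algebraMap_ringClassField_surjective_of_discr_nonneg (hK : 0 ≤ NumberField.discr K) (ι : K →+* ℂ) (n : ℕ) :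
    Function.Surjective (algebraMap K (ringClassField K ι n)) := by
  intro z
  have hz : (z : ℂ) ∈ ι.fieldRange := by
    rw [← ringClassField_eq_fieldRange_of_discr_nonneg hK ι n]; exact z.2
  obtain ⟨k, hk⟩ := RingHom.mem_fieldRange.mp hz
  exact ⟨k, Subtype.ext (by rw [coe_algebraMap_ringClassField, hk])⟩

/-- For `d_K ≥ 0`, `algebraMap (𝓞 K) (𝓞 K[n])` is onto (integrality descends along the injection `K → K[n]`). [folklore] -/
private theorem algebraMap_ringOfIntegers_ringClassField_surjective_of_discr_nonneg (hK : 0 ≤ NumberField.discr K)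
    (ι : K →+* ℂ) (n : ℕ) :
    Function.Surjective (algebraMap (𝓞 K) (𝓞 (ringClassField K ι n))) := by
  intro w
  obtain ⟨k, hk⟩ := algebraMap_ringClassField_surjective_of_discr_nonneg hK ι n (w : ringClassField K ι n)
  have hint : IsIntegral ℤ k := by
    have hw : IsIntegral ℤ (w : ringClassField K ι n) := w.isIntegral_coe
    rw [← hk] at hw
    exact (isIntegral_algebraMap_iff (algebraMap K (ringClassField K ι n)).injective).mp hw
  refine ⟨⟨k, hint⟩, RingOfIntegers.ext ?_⟩
  change algebraMap K (ringClassField K ι n) k = (w : ringClassField K ι n)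
  exact hk

/-- For `d_K ≥ 0`, `algebraMap (𝓞 K) (𝓞 K[n])` is a bijection. [folklore] -/
private theorem algebraMap_ringOfIntegers_ringClassField_bijective_of_discr_nonneg (hK : 0 ≤ NumberField.discr K)
    (ι : K →+* ℂ) (n : ℕ) :
    Function.Bijective (algebraMap (𝓞 K) (𝓞 (ringClassField K ι n))) := by
  refine ⟨fun x y hxy ↦ RingOfIntegers.ext ((algebraMap K (ringClassField K ι n)).injective ?_),
    algebraMap_ringOfIntegers_ringClassField_surjective_of_discr_nonneg hK ι n⟩
  have := congrArg (fun w : 𝓞 (ringClassField K ι n) ↦ (w : ringClassField K ι n)) hxy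
  exact this

/-- For `d_K ≥ 0`: an ideal `v` of `𝓞_K` whose extension to `𝓞_{K[n]}` is principal, `= (u)`, is itself principal, `v = (k)` with
`k ↦ u`. [folklore] -/
private theorem exists_eq_span_of_span_eq_map_of_discr_nonneg (hK : 0 ≤ NumberField.discr K) (ι : K →+* ℂ) (n : ℕ)
    (u : 𝓞 (ringClassField K ι n)) (v : Ideal (𝓞 K))
    (hspan : Ideal.span {u} = v.map (algebraMap (𝓞 K) (𝓞 (ringClassField K ι n)))) :
    ∃ k : 𝓞 K, algebraMap (𝓞 K) (𝓞 (ringClassField K ι n)) k = u ∧ v = Ideal.span {k} := by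
  have hbij := algebraMap_ringOfIntegers_ringClassField_bijective_of_discr_nonneg hK ι n
  obtain ⟨k, hk⟩ := hbij.2 u
  refine ⟨k, hk, ?_⟩
  rw [← Ideal.comap_map_of_bijective (algebraMap (𝓞 K) (𝓞 (ringClassField K ι n))) hbij (I := v), ← hspan, ← hk,
    ← Set.image_singleton, ← Ideal.map_span, Ideal.comap_map_of_bijective _ hbij]

/-! ## §2 (F-D) as typed is FALSE: the instances `K = ℚ` and `d_K = 8` -/

/-- **(F-D) at `K = ℚ` forces `η(i)/η(49i) = ±7`.** `d_ℚ = 1`, `⟨β = 1, reps = {(49,1,0)}⟩` is a `HeegnerDatum 49 1` (every level-`49`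
"Heegner form" of discriminant `1` has the junk point `τ = i`, so there is one `Γ₀(49)`-orbit), `ℚ[1] = ℚ`, and a prime `v ∋ 7` of
`𝓞_ℚ = ℤ` is `(7)`; so (F-D) yields `u ∈ ℤ` with `(u) = (7)` and `u = η(i)/η(49i)`. [folklore] -/
private theorem eta_junk_eq_seven_or_neg_seven_of_deuring
    (h : (∀ (K : Type) [Field K] [NumberField K] (ι : K →+* ℂ) (H : HeegnerDatum 49 (NumberField.discr K)) (Q : ℤ × ℤ × ℤ),
      Q ∈ H.reps →
      ∃ (u : 𝓞 (ringClassField K ι 1)) (v : HeightOneSpectrum (𝓞 K)),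
        ((u : ringClassField K ι 1) : ℂ) =
            ModularForm.eta (heegnerTau Q) / ModularForm.eta (UpperHalfPlane.ofComplex (49 * ((heegnerTau Q : ℍ) : ℂ))) ∧
        (7 : 𝓞 K) ∈ v.asIdeal ∧
        Ideal.span {u} = v.asIdeal.map (algebraMap (𝓞 K) (𝓞 (ringClassField K ι 1))))) :
    ModularForm.eta ((UpperHalfPlane.I : ℍ) : ℂ) /
        ModularForm.eta (UpperHalfPlane.ofComplex (49 * ((UpperHalfPlane.I : ℍ) : ℂ))) = 7 ∨
      ModularForm.eta ((UpperHalfPlane.I : ℍ) : ℂ) /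
        ModularForm.eta (UpperHalfPlane.ofComplex (49 * ((UpperHalfPlane.I : ℍ) : ℂ))) = -7 := by
  have hd : NumberField.discr ℚ = 1 := Rat.numberField_discr
  have hQ₀ : ¬ (0 < ((49 : ℤ), (1 : ℤ), (0 : ℤ)).1 ∧
      ((49 : ℤ), (1 : ℤ), (0 : ℤ)).2.1 ^ 2 - 4 * ((49 : ℤ), (1 : ℤ), (0 : ℤ)).1 * ((49 : ℤ), (1 : ℤ), (0 : ℤ)).2.2 < 0) := by
    norm_num
  let H : HeegnerDatum 49 (NumberField.discr ℚ) :=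
    { β := 1
      dvd_sq_sub := by rw [hd]; norm_num
      reps := {((49 : ℤ), (1 : ℤ), (0 : ℤ))}
      mem_heegnerForms := by
        intro Q hQ
        rw [Finset.mem_singleton] at hQ
        subst hQ
        rw [hd]
        exact ⟨⟨by norm_num, by norm_num, ⟨1, by norm_num⟩, fun d _ h1 _ ↦ isUnit_of_dvd_one h1⟩, Int.ModEq.refl _⟩
      pairwise_not_isGamma0Equiv := by simp
      exists_isGamma0Equiv := by
        intro Q hQ _
        refine ⟨_, Finset.mem_singleton_self _, 1, ?_⟩
        rw [one_smul, heegnerTau_of_not_posDef hQ₀, heegnerTau_of_not_posDef]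
        rw [hQ.1, hd]
        norm_num }
  obtain ⟨u, v, hu, h7, hspan⟩ := h ℚ (algebraMap ℚ ℂ) H _ (Finset.mem_singleton_self _)
  obtain ⟨k, hk, hv⟩ := exists_eq_span_of_span_eq_map_of_discr_nonneg (K := ℚ) (by rw [hd]; norm_num) _ 1 u v.asIdeal hspan
  -- `k ∈ 𝓞_ℚ` is an integer `m`, and `(k) = v ∋ 7` is a proper ideal: `m ∣ 7`, `m ≠ ±1`
  obtain ⟨m, hm⟩ := IsIntegrallyClosed.isIntegral_iff.mp k.isIntegral_coe
  replace hm : (m : ℚ) = (k : ℚ) := by rw [← eq_intCast (algebraMap ℤ ℚ) m]; exact hm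
  rw [hv, Ideal.mem_span_singleton] at h7
  obtain ⟨a, ha⟩ := h7
  obtain ⟨m', hm'⟩ := IsIntegrallyClosed.isIntegral_iff.mp a.isIntegral_coe
  replace hm' : (m' : ℚ) = (a : ℚ) := by rw [← eq_intCast (algebraMap ℤ ℚ) m']; exact hm'
  have h7Q : ((7 : 𝓞 ℚ) : ℚ) = (k : ℚ) * (a : ℚ) := by rw [ha]; push_cast; rfl
  have hmm' : m * m' = 7 := by
    have : ((m * m' : ℤ) : ℚ) = ((7 : ℤ) : ℚ) := by
      push_cast
      rw [hm, hm', ← h7Q]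
      rfl
    exact_mod_cast this
  have hne : v.asIdeal ≠ ⊤ := v.isPrime.ne_top
  have hm1 : m.natAbs ≠ 1 := by
    intro h1
    apply hne
    rw [hv, Ideal.span_singleton_eq_top]
    refine IsUnit.of_mul_eq_one k ?_
    apply RingOfIntegers.ext
    have hk1 : (k : ℚ) * (k : ℚ) = 1 := by
      rw [← hm]
      rcases Int.natAbs_eq_iff.mp h1 with h | h <;> simp [h]
    simpa using hk1
  have hm7 : m.natAbs = 7 := by
    have hdvd : m.natAbs ∣ 7 := Int.natAbs_dvd_natAbs.mpr ⟨m', hmm'.symm⟩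
    rcases (Nat.dvd_prime (by norm_num)).mp hdvd with h | h
    · exact absurd h hm1
    · exact h
  -- the value of `u` in `ℂ` is `m`
  have huC : ((u : ringClassField ℚ (algebraMap ℚ ℂ) 1) : ℂ) = (m : ℂ) := by
    rw [← hk]
    change algebraMap ℚ ℂ (k : ℚ) = _
    rw [← hm, map_intCast]
  rw [heegnerTau_of_not_posDef hQ₀] at hu
  rw [← hu, huC]
  rcases Int.natAbs_eq_iff.mp hm7 with h | h
  · left; rw [h]; norm_num
  · right; rw [h]; norm_num

/-- **(F-D) IN ITS OVER-GENERAL TYPING (every number field `K`, no `IsImaginaryQuadratic K`; the body of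
`deuring_etaQuotient49_heegner_generates_conjPrime` as it stood until 2026-08-28, spelled out inline so that this theorem survives the
in-place repair of that definition) IS FALSE.** At a real quadratic field `K` of discriminant `8` (`ℚ(√2)`, which exists:
`Quadratic.exists_numberField_discr_eq`) the triple `(98, 20, 1)` is a level-`49` "Heegner form" of discriminant `8` with
`B ≡ 20`, `20² ≡ 8 (mod 196)`, all such forms have the junk point `i`, `K[1] = ι(K)`, and (F-D) yields `u ∈ 𝓞_K` with
`ι(u) = η(i)/η(49i) = ±7` (the value forced by the instance `K = ℚ`, `eta_junk_eq_seven_or_neg_seven_of_deuring`) and `(u) = (7) = v`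
a PRIME of `𝓞_K` — but `7` splits in `ℚ(√2)` (`(8/7) = +1`, `RingClass.isPrime_span_natCast_iff_jacobiSym_eq_neg_one`). The
mathematical content of (F-D) (Deuring, Lang EF Ch. 12 §2 Thm 5, for `K` IMAGINARY QUADRATIC) is untouched: see the repaired
statement `deuring_etaQuotient49_heegner_generates_conjPrime'`. [cite: Lang1987, Ch. 12 §2 Thm. 4 and Thm. 5]
[cite: Cox2013, §5.B Prop. 5.16] -/
theorem not_deuring_etaQuotient49_heegner_generates_conjPrime :
    ¬ (∀ (K : Type) [Field K] [NumberField K] (ι : K →+* ℂ) (H : HeegnerDatum 49 (NumberField.discr K)) (Q : ℤ × ℤ × ℤ),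
      Q ∈ H.reps →
      ∃ (u : 𝓞 (ringClassField K ι 1)) (v : HeightOneSpectrum (𝓞 K)),
        ((u : ringClassField K ι 1) : ℂ) =
            ModularForm.eta (heegnerTau Q) / ModularForm.eta (UpperHalfPlane.ofComplex (49 * ((heegnerTau Q : ℍ) : ℂ))) ∧
        (7 : 𝓞 K) ∈ v.asIdeal ∧
        Ideal.span {u} = v.asIdeal.map (algebraMap (𝓞 K) (𝓞 (ringClassField K ι 1)))) := by
  intro h
  have h7 := eta_junk_eq_seven_or_neg_seven_of_deuring h
  -- a real quadratic field of discriminant `8`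
  obtain ⟨K, hF, hNF, h2, hdK⟩ := Literature.NumberTheory.QuadraticFields.Quadratic.exists_numberField_discr_eq (D := 8)
    (Or.inr ⟨⟨2, rfl⟩, by norm_num, by norm_num⟩)
  obtain ⟨ι⟩ : Nonempty (K →+* ℂ) := by
    rw [← Fintype.card_pos_iff, NumberField.Embeddings.card, h2]; norm_num
  have hQ₀ : ¬ (0 < ((98 : ℤ), (20 : ℤ), (1 : ℤ)).1 ∧
      ((98 : ℤ), (20 : ℤ), (1 : ℤ)).2.1 ^ 2 - 4 * ((98 : ℤ), (20 : ℤ), (1 : ℤ)).1 * ((98 : ℤ), (20 : ℤ), (1 : ℤ)).2.2 < 0) := by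
    norm_num
  let H : HeegnerDatum 49 (NumberField.discr K) :=
    { β := 20
      dvd_sq_sub := by rw [hdK]; norm_num
      reps := {((98 : ℤ), (20 : ℤ), (1 : ℤ))}
      mem_heegnerForms := by
        intro Q hQ
        rw [Finset.mem_singleton] at hQ
        subst hQ
        rw [hdK]
        exact ⟨⟨by norm_num, by norm_num, ⟨2, by norm_num⟩, fun d _ _ h1 ↦ isUnit_of_dvd_one h1⟩, Int.ModEq.refl _⟩
      pairwise_not_isGamma0Equiv := by simp
      exists_isGamma0Equiv := by
        intro Q hQ _
        refine ⟨_, Finset.mem_singleton_self _, 1, ?_⟩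
        rw [one_smul, heegnerTau_of_not_posDef hQ₀, heegnerTau_of_not_posDef]
        rw [hQ.1, hdK]
        norm_num }
  obtain ⟨u, v, hu, h7v, hspan⟩ := h K ι H _ (Finset.mem_singleton_self _)
  obtain ⟨k, hk, hv⟩ := exists_eq_span_of_span_eq_map_of_discr_nonneg (K := K) (by rw [hdK]; norm_num) ι 1 u v.asIdeal
    hspan
  rw [heegnerTau_of_not_posDef hQ₀] at hu
  -- `ι k = ±7`, so `k = ±7` and `v = (7)`
  have hιk : ι (k : K) = ((u : ringClassField K ι 1) : ℂ) := by
    rw [← hk]; rfl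
  obtain ⟨s, hs7, hks⟩ : ∃ s : ℤ, (s = 7 ∨ s = -7) ∧ (k : K) = s := by
    rcases h7 with h | h
    · exact ⟨7, Or.inl rfl, ι.injective (by rw [hιk, hu, h, Int.cast_ofNat, map_ofNat])⟩
    · exact ⟨-7, Or.inr rfl, ι.injective (by rw [hιk, hu, h, Int.cast_neg, Int.cast_ofNat, map_neg, map_ofNat])⟩
  have hk7 : Ideal.span {k} = Ideal.span {((7 : ℕ) : 𝓞 K)} := by
    have hk' : k = (s : 𝓞 K) := RingOfIntegers.ext (by rw [hks]; rfl)
    rw [hk']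
    rcases hs7 with rfl | rfl
    · simp
    · rw [show ((-7 : ℤ) : 𝓞 K) = -((7 : ℕ) : 𝓞 K) by push_cast; ring, Ideal.span_singleton_neg]
  have hprime : (Ideal.span {((7 : ℕ) : 𝓞 K)}).IsPrime := by
    rw [← hk7, ← hv]; exact v.isPrime
  have hj := (Literature.NumberTheory.QuadraticFields.RingClass.isPrime_span_natCast_iff_jacobiSym_eq_neg_one h2
    (by norm_num) (by norm_num)).mp hprime
  rw [hdK] at hj
  norm_num at hj

end Literature.NumberTheory.EllipticCurves

end
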